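import Summits.Ventures.QEC.Census.CertInfoSetOrbitFastSound
import Summits.Ventures.QEC.Census.CertCheckParityFast
import Summits.Ventures.QEC.Census.CertBZPlaneSound
import Summits.Ventures.QEC.Census.BB.TwoBlockKernelWeightCounterexample80.Cert
import Summits.Ventures.QEC.Census.BB.BBRows
import Literature.InformationTheory.QuantumCodes.CSSParameters
import Literature.InformationTheory.QuantumCodes.BivariateBicycleCodes
import Literature.InformationTheory.QuantumCodes.AbelianTwoBlockPaddedLogicals
import HarnessLib

/-!
# A third kernel instance of the X-2 dichotomy: the `[[80, 20, 8]]` code `QC80 = QC(A, B)` on `ℤ₂ × ℤ₂₀`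
# with a weight-4 subgroup indicator in `ker A ∩ ker B` — `d = 8 = 2 · 4` (tier KERNEL)

Companion of `Census/BB/TwoBlockKernelWeightCounterexample.lean` (`QC48`, `[[48,12,6]]` on `ℤ₂ × ℤ₁₂`, refuting the qec cell's
data-conjecture X-2 `d ≤ d(ker A ∩ ker B)`) and `Census/BB/TwoBlockKernelWeightCounterexample72.lean` (`QC72`, `[[72,18,6]]` on
`ℤ₆ × ℤ₆`); context, conventions and honest framing as there.  Here the distance reaches TWICE the kernel weight:
`QC80 := QC(A, B)` on `ℤ₂ × ℤ₂₀` (`BB.Code 2 20`, `x` of order 2, `y` of order 20, BCGMRY24 §4 conventions of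
`BivariateBicycleCodes.lean`) with
`A = 1 + y^3 + y^6 + y^11 + y^12 + y^18 + x + x y^6 + x y^11 + x y^12 + x y^13 + x y^18` (12 monomials) and
`B = y^4 + y^8 + y^10 + y^14 + y^15 + y^17 + y^18 + x y^2 + x y^3 + x y^6 + x y^10 + x y^12 + x y^13 + x y^15 + x y^16 + x y^17` (16 monomials);
`(A, B)` generate the augmentation ideal `I_H` of `H = {(0,0), (1,0), (0,10), (1,10)} ≅ ℤ₂ × ℤ₂` (qec-search-3 g7, census/search-3/x2 e16/e17:
the `n = 80` member of the rate-1/4 family `k = 2[G:H]`).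

* `Cex80.*` — the KERNEL replay of the certificate DATA `Census/BB/TwoBlockKernelWeightCounterexample80/Cert.lean` through
  qec-search-4's ORBIT-AVERAGED INFORMATION-SET lane (`CertInfoSetOrbitFastSound`: automorphism generators/words checked, RREF views,
  orbit-multiplicity profiles, type-01 lane-engine replay of each view's kernel basis to depth 4 against the allow-list of the 20
  weight-4 coset stabilizers, both sides; rank certificates) ending in `Cex80.isCode : (Cex80.cert.code _).IsCode 80 20 8` —
  emitted by `census/search-4/tools/gen4/emit_orbit_row.py` (search-4 g4/g5), every word re-checked here by `decide +kernel`
  (whole file ≈ 15 s on the farm);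
* `Cex80.HX_eq_rowsX`, `Cex80.HZ_eq_rowsZ` — the certificate's check words ARE `BBRows.rowsX/rowsZ la80c lb80c`, so
  `QC80_dZ`, `QC80_dX`, `QC80_d` (`= 8`), `QC80_k` (`= 20`), `QC80_finrank_kerInter` (`= 10`) follow by type-05's transport
  `BB.Code.dZ_eq_of_flat` / `dX_eq_of_flat` / `k_eq_of_flat` — **`QC80` is an `[[80, 20, 8]]` code**, KERNEL;
* `eH80`, `eH80_mem_kerInter`, `hammingNorm_eH80` — the indicator of `H` lies in `ker A ∩ ker B` with weight `4`;
* `exists_css_dZ_eq_two_mul_hammingNorm_ker` — so on `ℤ₂ × ℤ₂₀` there is an abelian two-block code and a non-zero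
  `e ∈ ker A ∩ ker B` with `d_Z = d_X = 8 = 2 · |e|` (the universal negations of X-2 are in the `QC48` file and are not restated).

HONEST FRAMING: an instance of OUR OWN dichotomy (FINDINGS X-2; for cyclic `G` the bound `d ≤ d(K)` is Wang–Pryadko 2022 St. 2, not
ours); `QC80` is NOT a census row (check weight 28) and no statement about any printed code is made or used.  Tier KERNEL: axioms ⊆
{propext, Classical.choice, Quot.sound}, no `native_decide`; 0 kit.
-/

set_option autoImplicit false
set_option Elab.async false

namespace Summit.Ventures.QEC.Census.TwoBlockKernelWeight

open Matrix Literature.InformationTheory.QuantumCodes BBRows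

/-! ## The code `QC80 = QC(A, B)` on `ℤ₂ × ℤ₂₀` -/

/-- Monomials `xⁱyʲ ↦ (i, j)` of `A = 1 + y^3 + y^6 + y^11 + y^12 + y^18 + x + x y^6 + x y^11 + x y^12 + x y^13 + x y^18` (`x` of order 2, `y` of order 20). -/
def la80c : List (BB.Mono 2 20) := [(0, 0), (0, 3), (0, 6), (0, 11), (0, 12), (0, 18), (1, 0), (1, 6), (1, 11), (1, 12), (1, 13), (1, 18)]

/-- Monomials of `B = y^4 + y^8 + y^10 + y^14 + y^15 + y^17 + y^18 + x y^2 + x y^3 + x y^6 + x y^10 + x y^12 + x y^13 + x y^15 + x y^16 + x y^17`. -/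
def lb80c : List (BB.Mono 2 20) := [(0, 4), (0, 8), (0, 10), (0, 14), (0, 15), (0, 17), (0, 18), (1, 2), (1, 3), (1, 6), (1, 10), (1, 12), (1, 13), (1, 15), (1, 16), (1, 17)]

/-- `QC80 = QC(A, B)` on `ℤ₂ × ℤ₂₀`: the typed two-block (bivariate-bicycle-type) code with `A = polyL la80c`, `B = polyL lb80c`
(`H^X = [A|B]`, `H^Z = [Bᵀ|Aᵀ]`, BCGMRY24 §4 conventions of `BivariateBicycleCodes.lean`). (definition) -/
def QC80 : BB.Code 2 20 := ⟨polyL la80c, polyL lb80c⟩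

/-! ## Kernel replay of the certificate (orbit-averaged information-set lane; emitted part, statements name `Cex80.cert`) -/

namespace Cex80

open Matrix Literature.InformationTheory.QuantumCodes Summit.Ventures.QEC.Census

/-! ## Structural checks (KERNEL) -/

/-- Commutation `H^X (H^Z)ᵀ = 0` through the RREF view `viewZ0` (qec-search-4 `commOKR`: every `H^X` row is the XOR of reduced rows
named by its pivot bits, every `H^Z` row the XOR of kernel-basis words named by its free bits; no popcounts). -/
theorem comm_ok : commOKR Cex80.cert.n Cex80.cert.HX Cex80.cert.HZ Cex80.viewZ0.ic = true := by
  decide +kernel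

/-- O2 commutation (from `comm_ok`), O5 both upper witnesses (weights 8/8) with their non-membership witnesses, O6 (a) both
allow-lists — assembled by `DistCert.checkStructure_of_parts` from the fast part verdicts. -/
theorem checkStructure_ok : Cex80.cert.checkStructure = true :=
  Cex80.cert.checkStructure_of_parts (by decide) (commOK_of_comm (comm_of_commOKR comm_ok))
    (by decide +kernel) (by decide +kernel) (by decide +kernel) (by decide +kernel) (by decide +kernel) (by decide +kernel)

/-- Rank certificate of `H^X` (`r = 30`). -/
theorem rankX_ok : Cex80.rcX.check Cex80.cert.n Cex80.cert.HX = true :=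
  RankCert.check_of_checkQ (by decide) (by decide +kernel)

/-- Rank certificate of `H^Z` (`r = 30`). -/
theorem rankZ_ok : Cex80.rcZ.check Cex80.cert.n Cex80.cert.HZ = true :=
  RankCert.check_of_checkQ (by decide) (by decide +kernel)

/-! ## `Z` side: automorphisms, views, profiles, replays -/

/-- `Z`-side generator 0: valid table, row maps on `H^X` and `H^Z` (type-12 `autGenOKFast`, one-pass transports). -/
theorem genZ_ok_0 : autGenOKFast Cex80.cert.n Cex80.cert.HX Cex80.cert.HZ (Cex80.orbZ.gens.getD 0 ⟨[], [], []⟩) = true := by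
  decide +kernel

/-- `Z`-side generator 1: valid table, row maps on `H^X` and `H^Z` (type-12 `autGenOKFast`, one-pass transports). -/
theorem genZ_ok_1 : autGenOKFast Cex80.cert.n Cex80.cert.HX Cex80.cert.HZ (Cex80.orbZ.gens.getD 1 ⟨[], [], []⟩) = true := by
  decide +kernel

/-- The `Z`-side generator check (type-12 `autGensOKFast`, assembled from the per-generator verdicts). -/
theorem gensZ_ok : autGensOKFast Cex80.cert.n Cex80.cert.HX Cex80.cert.HZ Cex80.orbZ.gens = true :=
  autGensOKFast_cons genZ_ok_0 (autGensOKFast_cons genZ_ok_1 (autGensOKFast_nil))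

/-- Every `Z`-side word names generators. -/
theorem wordsZ_ok : autWordsOK Cex80.orbZ.gens.length Cex80.orbZ.words = true := by
  decide +kernel

/-- Every `Z`-side view is a reduced-row-echelon certificate of `H^X` (search-7 `infoSetStructOK`). -/
theorem viewsZ_ok : ∀ s, s < Cex80.orbZ.views.length →
    infoSetStructOK Cex80.cert.n Cex80.cert.HX (Cex80.orbZ.views.getD s dfltView).ic = true := by
  decide +kernel

set_option maxHeartbeats 400000000 in
/-- **The `Z`-side profile check** at threshold `7`: the 40 automorphism tables composed from the words, the orbit
multiplicity of every qubit recounted for every view, and every class profile of total size `1 … 7` has a view `s` with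
`Σ_j p_j μ[j][s] < 40 · (t_s + 1)` (depths [4]). -/
theorem profZ_ok : orbitProfileOKF Cex80.cert.n (Cex80.cert.dZ - 1) (autPerms Cex80.orbZ.gens) Cex80.orbZ.words
    Cex80.orbZ.views Cex80.orbZ.cls Cex80.orbZ.mu = true := by
  decide +kernel

/-- The kernel-basis words of view 0 are below `2^80`. -/
theorem pGZ_0_lt : ∀ g ∈ Cex80.pGZ_0, g < 2 ^ 80 := by decide +kernel

set_option maxHeartbeats 400000000 in
/-- `Z` view 0, lane segment `[0, 50)` (251175 lanes, depth 4, threshold 7; est 7 s): every selection with largest row there passes (lane engine, KERNEL). -/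
theorem psegZ_0_0 : Plane.segOK 80 7 (Cex80.cert.sideZ.found.map Prod.fst) Cex80.pGZ_0 4 0 50 21 = true := by
  decide +kernel

/-- View 0 of the `Z` side: the replay reaches every selection of `≤ 4` kernel-basis words (KERNEL; 1 lane segment(s)). -/
theorem preachZ_0 : Reaches (bzLeaf 7 (Cex80.cert.sideZ.found.map Prod.fst)) (rowPos Cex80.pGZ_0 0) 4 0 0 :=
  Plane.reaches_of_segList 80 7 (Cex80.cert.sideZ.found.map Prod.fst) Cex80.pGZ_0 4 21 pGZ_0_lt [(0, 50)] (by decide +kernel)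
    (List.forall_mem_cons.2 ⟨psegZ_0_0, fun _ h => absurd h List.not_mem_nil⟩)

/-- All `Z`-side views are replayed to their depths. -/
theorem reachZ : ∀ s, s < Cex80.orbZ.views.length → Reaches (bzLeaf (Cex80.cert.dZ - 1) (Cex80.cert.sideZ.found.map Prod.fst))
    (rowPos (kerBasis Cex80.cert.n (Cex80.orbZ.views.getD s dfltView).ic.piv (Cex80.orbZ.views.getD s dfltView).ic.red) 0)
    (Cex80.orbZ.views.getD s dfltView).t 0 0 := by
  intro s hs
  have hs' : s < 1 := hs
  interval_cases s
  · exact preachZ_0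

/-- **`Z` lower bound**: every non-trivial `Z`-logical of the certificate's code has weight `> 7` (qec-search-4 `DistCert.lowZ_of_orbit`). -/
theorem lowZ : ∀ w : Fin Cex80.cert.n → ZMod 2, rowMatrix Cex80.cert.n Cex80.cert.HX *ᵥ w = 0 →
    w ∉ rowSpace (rowMatrix Cex80.cert.n Cex80.cert.HZ) → Cex80.cert.dZ - 1 < hammingNorm w :=
  Cex80.cert.lowZ_of_orbitF checkStructure_ok Cex80.orbZ gensZ_ok wordsZ_ok viewsZ_ok reachZ profZ_ok

/-! ## `X` side: automorphisms, views, profiles, replays -/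

/-- The `X`-side generator check, from the `Z`-side one (`autGensOKFast_swapRows`: same tables, row maps exchanged). -/
theorem gensX_ok : autGensOKFast Cex80.cert.n Cex80.cert.HZ Cex80.cert.HX Cex80.orbX.gens = true :=
  autGensOKFast_swapRows gensZ_ok

/-- Every `X`-side word names generators. -/
theorem wordsX_ok : autWordsOK Cex80.orbX.gens.length Cex80.orbX.words = true :=
  autWordsOK_swapRows wordsZ_ok

/-- Every `X`-side view is a reduced-row-echelon certificate of `H^Z` (search-7 `infoSetStructOK`). -/
theorem viewsX_ok : ∀ s, s < Cex80.orbX.views.length →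
    infoSetStructOK Cex80.cert.n Cex80.cert.HZ (Cex80.orbX.views.getD s dfltView).ic = true := by
  decide +kernel

set_option maxHeartbeats 400000000 in
/-- **The `X`-side profile check** at threshold `7`: the 40 automorphism tables composed from the words, the orbit
multiplicity of every qubit recounted for every view, and every class profile of total size `1 … 7` has a view `s` with
`Σ_j p_j μ[j][s] < 40 · (t_s + 1)` (depths [4]). -/
theorem profX_ok : orbitProfileOKF Cex80.cert.n (Cex80.cert.dX - 1) (autPerms Cex80.orbX.gens) Cex80.orbX.words
    Cex80.orbX.views Cex80.orbX.cls Cex80.orbX.mu = true := by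
  decide +kernel

/-- The kernel-basis words of view 0 are below `2^80`. -/
theorem pGX_0_lt : ∀ g ∈ Cex80.pGX_0, g < 2 ^ 80 := by decide +kernel

set_option maxHeartbeats 400000000 in
/-- `X` view 0, lane segment `[0, 50)` (251175 lanes, depth 4, threshold 7; est 7 s): every selection with largest row there passes (lane engine, KERNEL). -/
theorem psegX_0_0 : Plane.segOK 80 7 (Cex80.cert.sideX.found.map Prod.fst) Cex80.pGX_0 4 0 50 21 = true := by
  decide +kernel

/-- View 0 of the `X` side: the replay reaches every selection of `≤ 4` kernel-basis words (KERNEL; 1 lane segment(s)). -/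
theorem preachX_0 : Reaches (bzLeaf 7 (Cex80.cert.sideX.found.map Prod.fst)) (rowPos Cex80.pGX_0 0) 4 0 0 :=
  Plane.reaches_of_segList 80 7 (Cex80.cert.sideX.found.map Prod.fst) Cex80.pGX_0 4 21 pGX_0_lt [(0, 50)] (by decide +kernel)
    (List.forall_mem_cons.2 ⟨psegX_0_0, fun _ h => absurd h List.not_mem_nil⟩)

/-- All `X`-side views are replayed to their depths. -/
theorem reachX : ∀ s, s < Cex80.orbX.views.length → Reaches (bzLeaf (Cex80.cert.dX - 1) (Cex80.cert.sideX.found.map Prod.fst))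
    (rowPos (kerBasis Cex80.cert.n (Cex80.orbX.views.getD s dfltView).ic.piv (Cex80.orbX.views.getD s dfltView).ic.red) 0)
    (Cex80.orbX.views.getD s dfltView).t 0 0 := by
  intro s hs
  have hs' : s < 1 := hs
  interval_cases s
  · exact preachX_0

/-- **`X` lower bound**: every non-trivial `X`-logical of the certificate's code has weight `> 7` (qec-search-4 `DistCert.lowX_of_orbit`). -/
theorem lowX : ∀ w : Fin Cex80.cert.n → ZMod 2, rowMatrix Cex80.cert.n Cex80.cert.HZ *ᵥ w = 0 →
    w ∉ rowSpace (rowMatrix Cex80.cert.n Cex80.cert.HX) → Cex80.cert.dX - 1 < hammingNorm w :=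
  Cex80.cert.lowX_of_orbitF checkStructure_ok Cex80.orbX gensX_ok wordsX_ok viewsX_ok reachX profX_ok

/-! ## Distances both sides, `k`, the census predicate of the flat code -/

/-- **`d_Z = 8` for `Cex80`** (upper: the certificate's weight-8 `Z`-logical; lower: `lowZ`). -/
theorem dZ_eq : (Cex80.cert.code (Cex80.cert.commOK_of_checkStructure checkStructure_ok)).dZ = 8 :=
  Cex80.cert.dZ_code_of_orbitF checkStructure_ok Cex80.orbZ gensZ_ok wordsZ_ok viewsZ_ok reachZ profZ_ok (by decide)

/-- **`d_X = 8` for `Cex80`** (upper: the certificate's weight-8 `X`-logical; lower: `lowX`). -/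
theorem dX_eq : (Cex80.cert.code (Cex80.cert.commOK_of_checkStructure checkStructure_ok)).dX = 8 :=
  Cex80.cert.dX_code_of_orbitF checkStructure_ok Cex80.orbX gensX_ok wordsX_ok viewsX_ok reachX profX_ok (by decide)

/-- **`k = 20` for `Cex80`** (`k = n − rank H^X − rank H^Z = 80 − 30 − 30`, type-02 `RankCert`). -/
theorem k_eq : (Cex80.cert.code (Cex80.cert.commOK_of_checkStructure checkStructure_ok)).k = 20 := by
  rw [Cex80.cert.k_code _ rankX_ok rankZ_ok]
  decide

/-- **`Cex80.cert.code` (the flat form of `QC80`; NOT a census row) is an `[[80, 20, 8]]` code** — type-02's census predicate `CSSCode.IsCode`: `k = 80 − 30 − 30`,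
exact distances `d_Z = 8`, `d_X = 8` BOTH enumerated (orbit-averaged information sets); tier KERNEL. -/
theorem isCode : (Cex80.cert.code (Cex80.cert.commOK_of_checkStructure checkStructure_ok)).IsCode 80 20 8 := by
  have hk := k_eq
  have h := (Cex80.cert.code (Cex80.cert.commOK_of_checkStructure checkStructure_ok)).isCode_of_dX_dZ (by rw [hk]; decide) dX_eq dZ_eq
  rw [hk, Fintype.card_fin] at h
  exact h


/-! ### The certificate's words are the `BBRows` words of `QC80` -/

/-- The certificate's `H^X` words are `BBRows.rowsX la80c lb80c` (kernel evaluation of both lists). -/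
theorem HX_eq_rowsX : Cex80.cert.HX = rowsX la80c lb80c := by
  decide +kernel

/-- The certificate's `H^Z` words are `BBRows.rowsZ la80c lb80c`. -/
theorem HZ_eq_rowsZ : Cex80.cert.HZ = rowsZ la80c lb80c := by
  decide +kernel

set_option maxRecDepth 100000 in
/-- The certificate's flat `H^X` is `QC80.HXFlat` (`BBRows.rowMatrix_rowsX` along `HX_eq_rowsX`). -/
theorem rowMatrix_HX_eq : rowMatrix 80 Cex80.cert.HX = QC80.HXFlat := by
  have cast : ∀ {H H' : List ℕ} (e : H = H'),
      rowMatrix 80 H = (rowMatrix 80 H').submatrix (Fin.cast (congrArg List.length e)) id := by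
    intro H H' e; subst e; rfl
  exact (cast HX_eq_rowsX).trans (rowMatrix_rowsX QC80 (LA := la80c) (LB := lb80c) rfl rfl)

set_option maxRecDepth 100000 in
/-- The certificate's flat `H^Z` is `QC80.HZFlat`. -/
theorem rowMatrix_HZ_eq : rowMatrix 80 Cex80.cert.HZ = QC80.HZFlat := by
  have cast : ∀ {H H' : List ℕ} (e : H = H'),
      rowMatrix 80 H = (rowMatrix 80 H').submatrix (Fin.cast (congrArg List.length e)) id := by
    intro H H' e; subst e; rfl
  exact (cast HZ_eq_rowsZ).trans (rowMatrix_rowsZ QC80 (LA := la80c) (LB := lb80c) rfl rfl)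

end Cex80

/-! ## Parameters of the typed object `QC80` -/

set_option maxRecDepth 100000 in
/-- **`d_Z(QC80) = 8`** (KERNEL), transported from the flat certificate code by `BB.Code.dZ_eq_of_flat`. -/
theorem QC80_dZ : QC80.css.dZ = 8 :=
  (QC80.dZ_eq_of_flat (D := Cex80.cert.code (Cex80.cert.commOK_of_checkStructure Cex80.checkStructure_ok))
    Cex80.rowMatrix_HX_eq Cex80.rowMatrix_HZ_eq).symm.trans Cex80.dZ_eq

set_option maxRecDepth 100000 in
/-- **`d_X(QC80) = 8`** (KERNEL). -/
theorem QC80_dX : QC80.css.dX = 8 :=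
  (QC80.dX_eq_of_flat (D := Cex80.cert.code (Cex80.cert.commOK_of_checkStructure Cex80.checkStructure_ok))
    Cex80.rowMatrix_HX_eq Cex80.rowMatrix_HZ_eq).symm.trans Cex80.dX_eq

/-- **`d(QC80) = 8`** (`d = min(d_X, d_Z)`, KERNEL). -/
theorem QC80_d : QC80.d = 8 := QC80.d_eq_dZ.trans QC80_dZ

set_option maxRecDepth 100000 in
/-- **`k(QC80) = 20`** (KERNEL, rank certificates). -/
theorem QC80_k : QC80.k = 20 :=
  (QC80.k_eq_of_flat (D := Cex80.cert.code (Cex80.cert.commOK_of_checkStructure Cex80.checkStructure_ok))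
    Cex80.rowMatrix_HX_eq Cex80.rowMatrix_HZ_eq).symm.trans Cex80.k_eq

/-- `dim (ker A ∩ ker B) = 10` for `QC80` (from `k = 2 · dim (ker A ∩ ker B)`, BCGMRY24 Lemma 1, and `k = 20`): `= [G : H]`, so
`ker A ∩ ker B` is exactly the span of the 10 coset indicators of `H` (`Census/TwoBlockSubgroupKernelDimension.lean`). -/
theorem QC80_finrank_kerInter : Module.finrank (ZMod 2) QC80.kerInter = 10 := by
  have h := QC80.k_eq_two_mul_finrank_kerInter
  rw [QC80_k] at h
  omega

/-! ## The weight-4 element of `ker A ∩ ker B` -/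

/-- The indicator `1_H` of the subgroup `H = {(0,0), (1,0), (0,10), (1,10)} = ℤ₂ × 10ℤ₂₀ ≅ ℤ₂ × ℤ₂` of `ℤ₂ × ℤ₂₀`. (definition) -/
def eH80 : BB.Mono 2 20 → ZMod 2 := fun g => if g.2 = 0 ∨ g.2 = 10 then 1 else 0

/-- `1_H ≠ 0`. -/
theorem eH80_ne_zero : eH80 ≠ 0 := by decide

/-- `|1_H| = 4`. -/
theorem hammingNorm_eH80 : hammingNorm eH80 = 4 := by decide

/-- `A · 1_H = 0`: every coset of `H` meets the support of `A` in an even number of monomials (`decide`). -/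
theorem circulant_A_mulVec_eH80 : circulant (BB.coeffVec QC80.A) *ᵥ eH80 = 0 := by decide +kernel

/-- `B · 1_H = 0`. -/
theorem circulant_B_mulVec_eH80 : circulant (BB.coeffVec QC80.B) *ᵥ eH80 = 0 := by decide +kernel

/-- `1_H ∈ ker A ∩ ker B` (`BB.Code.kerInter`, `toMatrix = circulant ∘ coeffVec`). -/
theorem eH80_mem_kerInter : eH80 ∈ QC80.kerInter :=
  ⟨circulant_A_mulVec_eH80, circulant_B_mulVec_eH80⟩

/-! ## The instance -/

/-- `QC80.css` IS the abelian two-block code `css (coeffVec A) (coeffVec B)` of `AbelianTwoBlockParameters.lean` (definitional). -/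
theorem QC80_css_eq : QC80.css = AbelianTwoBlock.css (BB.coeffVec QC80.A) (BB.coeffVec QC80.B) := rfl

/-- `|ℤ₂ × ℤ₂₀| = 40` is even: the odd-order theorem `css_dZ_le_hammingNorm_of_card_odd` does not apply to `QC80`. -/
theorem not_odd_card_2_20 : ¬ Odd (Fintype.card (BB.Mono 2 20)) := by decide

/-- **Third kernel instance of the X-2 dichotomy, ratio 2.**  For the abelian two-block code `QC80` on `ℤ₂ × ℤ₂₀`
and `e = 1_H`: `e ≠ 0`, `A e = B e = 0`, `|e| = 4`, and `d_Z = d_X = 8 = 2 · |e|`. -/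
theorem exists_css_dZ_eq_two_mul_hammingNorm_ker :
    ∃ a b e : BB.Mono 2 20 → ZMod 2, e ≠ 0 ∧ circulant a *ᵥ e = 0 ∧ circulant b *ᵥ e = 0 ∧
      hammingNorm e = 4 ∧ (AbelianTwoBlock.css a b).dZ = 2 * hammingNorm e ∧ (AbelianTwoBlock.css a b).dX = 2 * hammingNorm e :=
  ⟨BB.coeffVec QC80.A, BB.coeffVec QC80.B, eH80, eH80_ne_zero, circulant_A_mulVec_eH80, circulant_B_mulVec_eH80,
    hammingNorm_eH80, by rw [hammingNorm_eH80, ← QC80_css_eq]; exact QC80_dZ, by rw [hammingNorm_eH80, ← QC80_css_eq]; exact QC80_dX⟩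

end Summit.Ventures.QEC.Census.TwoBlockKernelWeight
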